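import Summits.QuantumFields.BalabanUV.Beta.GAN24.WilsonSectorSourcePairingZero
import Summits.QuantumFields.BalabanUV.Beta.GAN24.CubicSectorLevelDown
import Summits.QuantumFields.BalabanUV.Beta.GAN24.MultiplierZeroMass
import Summits.QuantumFields.BalabanUV.Beta.KernelWardMColumn
import Summits.QuantumFields.BalabanUV.Beta.GAN24.ChargeTowerClimb
import Summits.QuantumFields.BalabanUV.Beta.GAN24.FieldResponseCoarseGradient

/-!
# `BalabanUV.Beta.GAN24.TwoLevelPairingIdentities` — binder row G-an2-4 ∕ (CONV-C), the (S) row ∕ (W-γ) one level up, the induction's algebraic step, PART 5a: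
# **THE TWO-LEVEL IDENTITY (C2) `⟨C_j(H_{j+1}h), σ_Ψ⊙H_{j+1}n⟩ = wVH_{j+1}⁻¹·⟨C_{j+1}h, σ_φ⊙n⟩ + (stepScale_{j+1} ∕ wVH_{j+1})·(C2′)_{j+1}(h; n; φ)` FOR GENERIC DATA
# (with the per-datum link `C_j(colH G_{j+1}(κ₀,w)) = (stepScale_{j+1} ∕ wVH_{j+1})·𝒬ᵀ_{Lc}(colM G_{j+1}(κ₀,w))` and the summability of the multiplier response)**
# (G-an2-4 CRUX TEAM (2), seat `b2b-balaban-gan24-formalise-leaf-02` = SUPPLIER side of leaf-06's (C2′)∕`hX` mechanism, gen 61; PART 5a, INTENT 5 ∕ OFFER O-leaf02-g61-2 —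
# the NAMED INPUT «the two-level identities (C1)∕(C2)» of leaf-06 g50's successor plan `LEVELS-GE2.md` §2–§3 (F2); (C1) is the SIBLING file PART 5b `TwoLevelPairingIdentitiesEnd` (import-independent of this one);
# the bounded-data link `C_j ∘ H_{j+1} = (stepScale_{j+1} ∕ wVH_{j+1})·𝒬ᵀ_{Lc} ∘ C_{j+1}` is leaf-06 g50's `FieldResponseCoarseGradient.multResponse_fieldResponse_eq`, IMPORTED)

NOT IN PRINT; OUR BOOKKEEPING ([folklore] BY NAME over leaf-06 g50 `FieldResponseCoarseGradient.multResponse_fieldResponse_eq` (the link between two levels on bounded data), leaf-06 g49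
(E3) `DataColumnCombRows.E2row_colH_eq_contourSumAdj_colM_succ` (Euler–Lagrange of the `ℋ`-columns of `G_{j+1}` at every bond), `KernelWardMColumn.colM_coDressKBmAt` ⨾
`MultiplierZeroMass.colM_KInvStep` (the multiplier columns are the tents `wΦ_{Lc^{j+1}}`, zero total mass), leaf-06 g46 `RelInvWardPairing.tsum_mul_contourSumAdj_bdd` (adjointness
of `𝒬`), leaf-06 g49 (α)
`BlockWeightContourCommutation.contourSum_bondSum_mul`, leaf-06 g49 (ε-Λ) `LambdaSlotWeightsTwoLevel.contourSum_fieldResponse` (`𝒬(H_k m) = stepScale_k⁻¹·m`), leaf-06 g50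
`CubicSectorLevelDown.summable_uncurry_mul_decay_mul_bdd` ∕ `summable_fieldResponse`, `ChargeTowerClimb.abs_tsum_sum_wΦ_mul_le`, PART 3 `abs_fieldResponse_le'`;
0 `def`, 0 cited fact, 0 `def … : Prop`, 0 sorry).
HONEST FRAMING (cell contract, verbatim): «discharging `BetaPertH` makes Bałaban's UV stability UNCONDITIONAL — a real constructive-QFT result; it is NOT the continuum limit and NOT
the Clay problem.»  HONEST DEPENDENCY (verbatim): «continuum YM on T⁴ ⇐ BetaPertH ∧ nine spine estimates (0/9 proved); BetaPertH ⇐ (D1) ∧ (D4) ∧ CAP+tail; G-an2-4 gates asym,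
D1 and NE2/3/4.»

WHY (leaf-06 g50 `LEVELS-GE2.md` §2, last paragraph, and §3 F2).  LETTERS: `G_k = coDressKBmAt ρ Lc (KInvStep Lc k)`; the field response `H_k m (a,v) = Σ_κ₀ Σ'_w m κ₀ w·colH G_k Lc κ₀ w a v`;
the multiplier response `(C_k m)(κ,Y) = Σ_κ₀ Σ'_w m κ₀ w·colM G_k Lc κ₀ w κ Y` (datum first, as in PART 4b and leaf-06 g50's `sourcePairing_levelOne_closed`; PART 2 writes the same
object with the two coarse bonds of `colM` exchanged — equal by PART 4a `colM_coDressKBmAt_KInvStep_swap`).  The cubic sector of `X_{j+2}` is `cH_{j+1}·X_{j+1}[SrecAt j]` at the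
COMPOSITE data `(H_{j+1}h, H_{j+1}n, φ∘blk)` (`CubicSectorLevelDown.cubicSector_SrecAt_eq_levelDown`), so the induction hypothesis «`X_{j+1} = A·⟨φ⁺⊙h, C_j n⟩ + B·⟨C_j h, σ_φ⊙n⟩ +
defects`» returns the two main terms at composite data, `⟨Ψ⁺⊙H_{j+1}h, C_j(H_{j+1}n)⟩` and `⟨C_j(H_{j+1}h), σ_Ψ⊙H_{j+1}n⟩` (`Ψ = φ∘blk`).  THIS FILE and PART 5b convert them to level
`j+2` letters: the multiplier column of `G_j` IS the level-`(j+1)` value Hessian `E2_{j+1} ∕ wVH_{j+1}` (the tent `wΦ_{Lc^{j+1}}`), so (E3) reads `C_j(colH G_{j+1}(κ₀,w)) =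
(stepScale_{j+1} ∕ wVH_{j+1})·𝒬ᵀ_{Lc}(colM G_{j+1}(κ₀,w))` per datum (§1 `colM_mul_colH_succ_eq_contourSumAdj`) and, summed against bounded data (Fubini; the tents have zero total
mass), **`C_j ∘ H_{j+1} = (stepScale_{j+1} ∕ wVH_{j+1})·𝒬ᵀ_{Lc} ∘ C_{j+1}`** (leaf-06 g50's `FieldResponseCoarseGradient.multResponse_fieldResponse_eq`, the β-chain link (i) — IMPORTED, not restated).  Then
PART 4b's level-0 mechanism runs one level up with `C_j` in place of `d*d`: adjointness moves `𝒬ᵀ` onto the block-constant-weighted response, (α) commutes the weight through `𝒬`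
producing the displayed defect, and the averaging constraint `𝒬(H_{j+1}m) = stepScale_{j+1}⁻¹·m` closes the main term.
* §1 `colM_coDressKBmAt_KInvStep_eq_wΦ`, **`colM_mul_colH_succ_eq_contourSumAdj`** (in-block root, per datum — (E3) in `colM` letters with the quotient on the right).
* §2 bounds: `summable_abs_multResponse` (`C_k h` absolutely summable, `h` summable along every direction), `abs_partialContour_le`, `abs_le_of_summable` (the bound `|C_k n| ≤ BC`
  for bounded `n` is PART 5b's `abs_multResponse_le'`).
* §3 **`pairing_multResponse_bondSum_eq`** = (C2) at the centred root (statement in the title; the `(C2′)_{j+1}` term is leaf-06 g49's (δ2b) object `Σ'_Y Σ_κ (C_{j+1}h)(κ,Y)·dzφ κ Y·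
  (BO_{Lc} − EI_{Lc})(H_{j+1}n)(κ,Y)` for GENERIC `h`).
Asserts NO value of any resolvent column beyond (E3), the averaging constraint and the zero mass of the tents; NOTHING of `hX` at `j ≥ 1` ∕ (W-γ) at levels ≥ 1 ∕ (S) above level 0 ∕
the lower-level defect vanishing (F1) ∕ the generic-level closed form (F2) ∕ the pins (F3) discharged — two algebraic inputs of that plan; NEVER «G-an2-4 closed» as (CONV-C); NOT D1,
NOT `BetaPertH`, NOT continuum, NOT Clay.  2026-08-23; no existing file touched.
-/

noncomputable section

open Finset
open scoped BigOperators
open Literature.MathematicalPhysics.QuantumFieldTheory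
open Literature.MathematicalPhysics.QuantumFieldTheory.Balaban1983to89
open Literature.MathematicalPhysics.QuantumFieldTheory.Balaban1983to89.Beta
open LatticeForm (quo)
open B12Sec2to5 (l1 l1_nonneg)
open ExpKernelCalculus (Site MKer Decays Zl summable_exp_shift')
open OneStepResolventKernel (Fib)
open AffineAveraging (Form0 Form1 box toSite unitVec unitVec_apply dz contourSum)
open AffineReproduction (contourSumAdj)
open KKTFluctuationEnergy (contourSumAdj_eq)
open AveragingContours (blk)
open AveragingContoursRooted (ctrOff ctrOff_mem_box)
open KernelSpecInstance (wΦ)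
open OneStepKernelFamily (KInvStep colH)
open SecondOrderResponse (colM)
open BalabanStepJetsSucc (wVH)
open Summit.QuantumFields.BalabanUV.Beta.AxialDressingRooted (coDressKBmAt decays_coDressKBmAt_KInvStep one_le_of_neZero)
open Summit.QuantumFields.BalabanUV.Beta.BorderedHessian (stepScale stepScale_ne_zero)
open Summit.QuantumFields.BalabanUV.Beta.LagrangeFoldStep (wVH_ne_zero)
open Summit.QuantumFields.BalabanUV.Beta.KernelWardMColumn (colM_coDressKBmAt)
open Summit.QuantumFields.BalabanUV.Beta.GAN24.MultiplierZeroMass (colM_KInvStep hasSum_colM_KInvStep_bond summable_wΦ)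
open Summit.QuantumFields.BalabanUV.Beta.GAN24.ChargeTowerClimb (abs_tsum_sum_wΦ_mul_le)
open Summit.QuantumFields.BalabanUV.Beta.GAN24.ContactCellRefine (summable_comp_quo')
open Summit.QuantumFields.BalabanUV.Beta.GAN24.DataColumnCombRows (E2row_colH_eq_contourSumAdj_colM_succ)
open Summit.QuantumFields.BalabanUV.Beta.GAN24.RelInvWardPairing (summable_bdd_mul tsum_mul_contourSumAdj_bdd)
open Summit.QuantumFields.BalabanUV.Beta.GAN24.BornLambdaVertexTent (summable_wΦ_shift)
open Summit.QuantumFields.BalabanUV.Beta.GAN24.CubicPushGaugeLegUnfoldingFF (abs_fieldResponse_le')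
open Summit.QuantumFields.BalabanUV.Beta.GAN24.CubicSectorLevelDown (summable_fieldResponse summable_uncurry_mul_decay_mul_bdd)
open Summit.QuantumFields.BalabanUV.Beta.GAN24.WilsonSectorGaugeLegUnfolding (tsum_mul_contourSumAdj_of_summable summable_abs_contourSum
  summable_abs_partialContour tsum_fieldResponse_mul_eq tsum_multResponse_mul_eq)
open Summit.QuantumFields.BalabanUV.Beta.GAN24.BlockWeightContourCommutation (contourSum_endWeight_mul contourSum_bondSum_mul)
open Summit.QuantumFields.BalabanUV.Beta.GAN24.LambdaSlotWeightsTwoLevel (contourSum_fieldResponse)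
open Summit.QuantumFields.BalabanUV.Beta.GAN24.FieldResponseCoarseGradient (multResponse_fieldResponse_eq)

namespace Summit.QuantumFields.BalabanUV.Beta.GAN24.TwoLevelPairingIdentities

variable {d : ℕ}

/-! ## §1 The link between two levels per datum: `C_j(colH G_{j+1}(κ₀,w)) = (stepScale_{j+1} ∕ wVH_{j+1})·𝒬ᵀ_{Lc}(colM G_{j+1}(κ₀,w))` -/

section Link
variable {Lc : ℕ} [NeZero Lc] {r : Fin (d + 1) → ℕ}

/-- [folklore] **THE MULTIPLIER COLUMN OF `G_j` IS THE EXPLICIT TENT `wΦ_{Lc^{j+1}}`** (co-dressing does not touch the `mm` block; `MultiplierZeroMass.colM_KInvStep`):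
`colM G_j Lc a v κ u = wΦ_{Lc^{j+1}} κ a (u − v)`. -/
theorem colM_coDressKBmAt_KInvStep_eq_wΦ (ρ : Site (d + 1)) (j : ℕ) (a : Fin (d + 1)) (v : Site (d + 1)) (κ : Fin (d + 1)) (u : Site (d + 1)) :
    colM (coDressKBmAt ρ Lc (KInvStep (d := d) Lc j)) Lc a v κ u = wΦ (N := Lc ^ (j + 1)) κ a (u - v) := by
  rw [colM_coDressKBmAt, colM_KInvStep]

/-- NOT IN PRINT; OUR BOOKKEEPING.  **THE LEVEL-`j` MULTIPLIER RESPONSE OF A LEVEL-`(j+1)` FIELD COLUMN IS THE COARSE GRADIENT OF ITS MULTIPLIER COLUMN** (in-block root, every `j`,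
PER DATUM `(κ₀, w)` of `G_{j+1}`, every fine bond `(κ, u)`): `Σ'_v Σ_a colM G_j Lc a v κ u·colH G_{j+1} Lc κ₀ w a v = (stepScale_{j+1} ∕ wVH_{j+1})·𝒬ᵀ_{Lc}(colM G_{j+1} Lc κ₀ w) κ u`
— leaf-06 g49 (E3) `DataColumnCombRows.E2row_colH_eq_contourSumAdj_colM_succ` (Euler–Lagrange of the `ℋ`-column of `G_{j+1}` at every bond) in `colM` letters (`C_j = E2_{j+1} ∕ wVH_{j+1}`). -/
theorem colM_mul_colH_succ_eq_contourSumAdj (hr : r ∈ box (d + 1) Lc) (j : ℕ) (κ₀ : Fin (d + 1)) (w : Site (d + 1)) (κ : Fin (d + 1)) (u : Site (d + 1)) :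
    ∑' v : Site (d + 1), ∑ a, colM (coDressKBmAt (toSite r) Lc (KInvStep (d := d) Lc j)) Lc a v κ u
        * colH (coDressKBmAt (toSite r) Lc (KInvStep (d := d) Lc (j + 1))) Lc κ₀ w a v
      = stepScale d Lc (j + 1) / wVH d Lc (j + 1)
        * contourSumAdj Lc (colM (coDressKBmAt (toSite r) Lc (KInvStep (d := d) Lc (j + 1))) Lc κ₀ w) κ u := by
  simp only [colM_coDressKBmAt_KInvStep_eq_wΦ (toSite r) j]
  have hw : wVH d Lc (j + 1) ≠ 0 := wVH_ne_zero (j + 1)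
  have h3 := E2row_colH_eq_contourSumAdj_colM_succ (d := d) hr j κ₀ w κ u
  calc (∑' v : Site (d + 1), ∑ a, wΦ (N := Lc ^ (j + 1)) κ a (u - v) * colH (coDressKBmAt (toSite r) Lc (KInvStep (d := d) Lc (j + 1))) Lc κ₀ w a v)
      = (wVH d Lc (j + 1))⁻¹ * (wVH d Lc (j + 1) * ∑' v : Site (d + 1), ∑ a, wΦ (N := Lc ^ (j + 1)) κ a (u - v)
          * colH (coDressKBmAt (toSite r) Lc (KInvStep (d := d) Lc (j + 1))) Lc κ₀ w a v) := by rw [inv_mul_cancel_left₀ hw]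
    _ = _ := by rw [h3]; field_simp

end Link

/-! ## §2 Bounds and summabilities of the multiplier response -/

section Bounds
variable {Lc : ℕ} [NeZero Lc]

/-- [folklore] **THE MULTIPLIER RESPONSE OF A SUMMABLE DATUM IS ABSOLUTELY SUMMABLE** (every root, every level `k`; `h` summable along every direction): `Y ↦ (C_k h)(κ,Y)` is absolutely
summable on the coarse lattice — the tent columns decay (`KernelSpecInstance.decay_wΦ`), so `(t, Y) ↦ h l t·colM G_k Lc l t κ Y` is an absolutely summable two-index family
(leaf-06 g50's `CubicSectorLevelDown.summable_uncurry_mul_decay_mul_bdd`). -/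
theorem summable_abs_multResponse (ρ : Site (d + 1)) (k : ℕ) {h : Form1 (d + 1) ℝ} (hh : ∀ l, Summable (h l)) (κ : Fin (d + 1)) :
    Summable fun Y : Site (d + 1) => |∑ l, ∑' t : Site (d + 1), h l t * colM (coDressKBmAt ρ Lc (KInvStep (d := d) Lc k)) Lc l t κ Y| := by
  obtain ⟨δ, C, hδ, hw⟩ := KernelSpecInstance.decay_wΦ (N := Lc ^ (k + 1)) (d := d)
  have hC : 0 ≤ C := by
    have h0 := (abs_nonneg _).trans (hw κ 0 0)
    exact (mul_nonneg_iff_of_pos_right (Real.exp_pos _)).1 h0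
  -- the two-index family per direction `l`
  have hF : ∀ l, Summable (Function.uncurry fun (t Y : Site (d + 1)) => h l t * (colM (coDressKBmAt ρ Lc (KInvStep (d := d) Lc k)) Lc l t κ Y * (1 : ℝ))) := by
    intro l
    refine summable_uncurry_mul_decay_mul_bdd (d := d) hδ hC zero_le_one (1 : ℤ) (hh l) (fun t Y => ?_) (fun _ => by simp)
    rw [colM_coDressKBmAt_KInvStep_eq_wΦ ρ k, one_zsmul]
    exact hw κ l (Y - t)
  -- fibre sums of its absolute value
  have hfib : ∀ l, Summable fun Y : Site (d + 1) => ∑' t : Site (d + 1), |h l t * colM (coDressKBmAt ρ Lc (KInvStep (d := d) Lc k)) Lc l t κ Y| := by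
    intro l
    have h1 := ((hF l).abs.prod_symm).prod
    refine h1.congr (fun Y => tsum_congr fun t => ?_)
    simp [Function.uncurry]
  have hfac : ∀ l (Y : Site (d + 1)), Summable fun t : Site (d + 1) => |h l t * colM (coDressKBmAt ρ Lc (KInvStep (d := d) Lc k)) Lc l t κ Y| := by
    intro l Y
    have h1 := ((hF l).abs.prod_symm).prod_factor Y
    refine h1.congr (fun t => ?_)
    simp [Function.uncurry]
  refine Summable.of_norm_bounded (g := fun Y => ∑ l : Fin (d + 1), ∑' t : Site (d + 1), |h l t * colM (coDressKBmAt ρ Lc (KInvStep (d := d) Lc k)) Lc l t κ Y|)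
    (summable_sum fun l (_ : l ∈ (Finset.univ : Finset (Fin (d + 1)))) => hfib l) (fun Y => ?_)
  rw [Real.norm_eq_abs, abs_abs]
  refine (Finset.abs_sum_le_sum_abs (fun l => ∑' t : Site (d + 1), h l t * colM (coDressKBmAt ρ Lc (KInvStep (d := d) Lc k)) Lc l t κ Y) Finset.univ).trans
    (Finset.sum_le_sum fun l _ => ?_)
  have h2 := norm_tsum_le_tsum_norm ((hfac l Y).congr fun t => (Real.norm_eq_abs _).symm)
  simpa only [Real.norm_eq_abs] using h2

/-- [folklore] A selected partial contour sum (`EI`, `BO`, …) of a bounded fine 1-form is bounded by `|box|·L·B`. -/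
theorem abs_partialContour_le {L : ℕ} {v : Form1 (d + 1) ℝ} {B : ℝ} (hv : ∀ κ u, |v κ u| ≤ B) (κ : Fin (d + 1)) (Y : Site (d + 1))
    (P : (Fin (d + 1) → ℕ) → ℕ → Prop) [∀ b s, Decidable (P b s)] :
    |∑ b ∈ box (d + 1) L, ∑ s ∈ Finset.range L, (if P b s then v κ ((L : ℤ) • Y + toSite b + (s : ℤ) • unitVec κ) else 0)|
      ≤ ((box (d + 1) L).card : ℝ) * L * B := by
  have hB : 0 ≤ B := (abs_nonneg _).trans (hv 0 0)
  refine (Finset.abs_sum_le_sum_abs _ _).trans ?_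
  refine (Finset.sum_le_sum fun b _ => (Finset.abs_sum_le_sum_abs _ _).trans
    (Finset.sum_le_sum fun s _ => show |(if P b s then v κ ((L : ℤ) • Y + toSite b + (s : ℤ) • unitVec κ) else 0)| ≤ B from ?_)).trans ?_
  · split_ifs
    · exact hv κ _
    · rw [abs_zero]; exact hB
  · rw [Finset.sum_const, Finset.sum_const, Finset.card_range, nsmul_eq_mul, nsmul_eq_mul]
    ring_nf
    exact le_rfl

/-- [folklore] A datum summable along every direction is bounded (by its `ℓ¹` mass). -/
theorem abs_le_of_summable {h : Form1 (d + 1) ℝ} (hh : ∀ l, Summable (h l)) (l : Fin (d + 1)) (t : Site (d + 1)) :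
    |h l t| ≤ ∑ l' : Fin (d + 1), ∑' t' : Site (d + 1), |h l' t'| := by
  have hha : ∀ l, Summable fun t => |h l t| := fun l => (hh l).abs
  calc |h l t| ≤ ∑' t' : Site (d + 1), |h l t'| := (hha l).le_tsum t (fun _ _ => abs_nonneg _)
    _ ≤ ∑ l' : Fin (d + 1), ∑' t' : Site (d + 1), |h l' t'| :=
        Finset.single_le_sum (f := fun l' => ∑' t' : Site (d + 1), |h l' t'|) (fun l' _ => tsum_nonneg fun _ => abs_nonneg _) (Finset.mem_univ l)

end Bounds

/-! ## §3 The two-level identity (C2): `⟨C_j(H_{j+1}h), σ_Ψ⊙H_{j+1}n⟩ = wVH_{j+1}⁻¹·⟨C_{j+1}h, σ_φ⊙n⟩ + (stepScale_{j+1}∕wVH_{j+1})·(C2′)_{j+1}(h; n; φ)` -/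

section C2
variable {Lc : ℕ} [NeZero Lc]

/-- NOT IN PRINT; OUR BOOKKEEPING.  **THE TWO-LEVEL IDENTITY (C2)** (centred root `ρ = toSite (ctrOff (d+1) Lc)`, every `j`; `h` summable along every direction, `n` bounded, `φ` a bounded
coarse potential, `Ψ = φ ∘ blk`, `σ_Ψ(κ,u) = Ψ u + Ψ(u + e_κ)`; `G_k = coDressKBmAt ρ Lc (KInvStep Lc k)`, `H_{j+1} m (a,v) = Σ_κ₀ Σ'_w m κ₀ w·colH G_{j+1} Lc κ₀ w a v`,
`(C_k m)(κ,Y) = Σ_κ₀ Σ'_w m κ₀ w·colM G_k Lc κ₀ w κ Y`):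
`Σ'_u Σ_κ (C_j(H_{j+1}h))(κ,u)·σ_Ψ(κ,u)·(H_{j+1}n)(κ,u) = wVH_{j+1}⁻¹·Σ'_Y Σ_κ (C_{j+1}h)(κ,Y)·σ_φ(κ,Y)·n κ Y + (stepScale_{j+1}∕wVH_{j+1})·Σ'_Y Σ_κ (C_{j+1}h)(κ,Y)·dzφ κ Y·(BO_{Lc} − EI_{Lc})(H_{j+1}n)(κ,Y)`
— the second term is leaf-06 g49's (δ2b) object `(C2′)_{j+1}(h; n; φ)` for GENERIC `h`.  Mechanism = PART 4b's one level up: leaf-06 g50's link `C_j∘H_{j+1} = (s∕w)·𝒬ᵀ∘C_{j+1}` (`FieldResponseCoarseGradient`), adjointness of `𝒬`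
(`RelInvWardPairing.tsum_mul_contourSumAdj_bdd`), (α) `contourSum_bondSum_mul`, the averaging constraint `𝒬(H_{j+1}n) = stepScale_{j+1}⁻¹·n` ((ε-Λ) `contourSum_fieldResponse`). -/
theorem pairing_multResponse_bondSum_eq (j : ℕ) {h : Form1 (d + 1) ℝ} (hh : ∀ l, Summable (h l)) {n : Form1 (d + 1) ℝ} {Bn : ℝ} (hn : ∀ κ u, |n κ u| ≤ Bn)
    {φ : Site (d + 1) → ℝ} {Bφ : ℝ} (hφ : ∀ y, |φ y| ≤ Bφ) :
    ∑' u : Site (d + 1), ∑ κ : Fin (d + 1),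
        (∑ a, ∑' v : Site (d + 1), (∑ l, ∑' t : Site (d + 1), h l t
            * colH (coDressKBmAt (toSite (ctrOff (d + 1) Lc)) Lc (KInvStep (d := d) Lc (j + 1))) Lc l t a v)
            * colM (coDressKBmAt (toSite (ctrOff (d + 1) Lc)) Lc (KInvStep (d := d) Lc j)) Lc a v κ u)
          * ((φ (blk Lc u) + φ (blk Lc (u + unitVec κ)))
            * ∑ κ₀, ∑' w : Site (d + 1), n κ₀ w * colH (coDressKBmAt (toSite (ctrOff (d + 1) Lc)) Lc (KInvStep (d := d) Lc (j + 1))) Lc κ₀ w κ u)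
      = (wVH d Lc (j + 1))⁻¹ * ∑' Y : Site (d + 1), ∑ κ : Fin (d + 1),
            (∑ l, ∑' t : Site (d + 1), h l t * colM (coDressKBmAt (toSite (ctrOff (d + 1) Lc)) Lc (KInvStep (d := d) Lc (j + 1))) Lc l t κ Y)
              * ((φ Y + φ (Y + unitVec κ)) * n κ Y)
        + stepScale d Lc (j + 1) / wVH d Lc (j + 1) * ∑' Y : Site (d + 1), ∑ κ : Fin (d + 1),
            (∑ l, ∑' t : Site (d + 1), h l t * colM (coDressKBmAt (toSite (ctrOff (d + 1) Lc)) Lc (KInvStep (d := d) Lc (j + 1))) Lc l t κ Y)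
              * (dz φ κ Y
                * ((∑ b ∈ box (d + 1) Lc, ∑ s ∈ Finset.range Lc, (if Lc ≤ b κ + s then
                      (∑ κ₀, ∑' w : Site (d + 1), n κ₀ w * colH (coDressKBmAt (toSite (ctrOff (d + 1) Lc)) Lc (KInvStep (d := d) Lc (j + 1))) Lc κ₀ w κ
                        ((Lc : ℤ) • Y + toSite b + (s : ℤ) • unitVec κ)) else 0))
                  - ∑ b ∈ box (d + 1) Lc, ∑ s ∈ Finset.range Lc, (if b κ + s + 1 < Lc then
                      (∑ κ₀, ∑' w : Site (d + 1), n κ₀ w * colH (coDressKBmAt (toSite (ctrOff (d + 1) Lc)) Lc (KInvStep (d := d) Lc (j + 1))) Lc κ₀ w κ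
                        ((Lc : ℤ) • Y + toSite b + (s : ℤ) • unitVec κ)) else 0))) := by
  classical
  have hLc1 : 1 ≤ Lc := one_le_of_neZero Lc
  have hr := ctrOff_mem_box (d := d + 1) hLc1
  have hBφ : 0 ≤ Bφ := (abs_nonneg _).trans (hφ 0)
  have hs : stepScale d Lc (j + 1) ≠ 0 := stepScale_ne_zero (j + 1)
  have hhB : ∀ l t, |h l t| ≤ ∑ l' : Fin (d + 1), ∑' t' : Site (d + 1), |h l' t'| := abs_le_of_summable hh
  have hw : wVH d Lc (j + 1) ≠ 0 := wVH_ne_zero (j + 1)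
  obtain ⟨BH, hBH0, hHnb⟩ := abs_fieldResponse_le' (d := d) hr (j + 1) hn
  -- (A₀) leaf-06 g50's link between the two levels (`wVH_{j+1}·C_j(H_{j+1}h) = stepScale_{j+1}·𝒬ᵀ(C_{j+1}h)`), the datum `h` bounded by its `ℓ¹` mass
  have hA0 := fun (κ : Fin (d + 1)) (u : Site (d + 1)) => multResponse_fieldResponse_eq (d := d) (Lc := Lc) j hhB κ u
  -- abbreviations
  set G' : MKer (d + 1) (Fib d) := coDressKBmAt (toSite (ctrOff (d + 1) Lc)) Lc (KInvStep (d := d) Lc (j + 1)) with hG'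
  set G : MKer (d + 1) (Fib d) := coDressKBmAt (toSite (ctrOff (d + 1) Lc)) Lc (KInvStep (d := d) Lc j) with hG
  set Hn : Form1 (d + 1) ℝ := fun κ u => ∑ κ₀, ∑' w : Site (d + 1), n κ₀ w * colH G' Lc κ₀ w κ u with hHn
  set Ch : Form1 (d + 1) ℝ := fun κ Y => ∑ l, ∑' t : Site (d + 1), h l t * colM G' Lc l t κ Y with hCh
  set m : Form1 (d + 1) ℝ := fun κ u => (φ (blk Lc u) + φ (blk Lc (u + unitVec κ))) * Hn κ u with hm
  set c : ℝ := stepScale d Lc (j + 1) / wVH d Lc (j + 1) with hc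
  show ∑' u : Site (d + 1), ∑ κ : Fin (d + 1), (∑ a, ∑' v : Site (d + 1), (∑ l, ∑' t : Site (d + 1), h l t * colH G' Lc l t a v) * colM G Lc a v κ u)
        * ((φ (blk Lc u) + φ (blk Lc (u + unitVec κ))) * Hn κ u)
      = (wVH d Lc (j + 1))⁻¹ * ∑' Y : Site (d + 1), ∑ κ : Fin (d + 1), Ch κ Y * ((φ Y + φ (Y + unitVec κ)) * n κ Y)
        + c * ∑' Y : Site (d + 1), ∑ κ : Fin (d + 1), Ch κ Y * (dz φ κ Y
          * ((∑ b ∈ box (d + 1) Lc, ∑ s ∈ Finset.range Lc, (if Lc ≤ b κ + s then Hn κ ((Lc : ℤ) • Y + toSite b + (s : ℤ) • unitVec κ) else 0))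
            - ∑ b ∈ box (d + 1) Lc, ∑ s ∈ Finset.range Lc, (if b κ + s + 1 < Lc then Hn κ ((Lc : ℤ) • Y + toSite b + (s : ℤ) • unitVec κ) else 0)))
  have hHnb' : ∀ κ u, |Hn κ u| ≤ BH := hHnb
  have hmB : ∀ κ u, |m κ u| ≤ 2 * Bφ * BH := fun κ u => by
    show |(φ (blk Lc u) + φ (blk Lc (u + unitVec κ))) * Hn κ u| ≤ 2 * Bφ * BH
    rw [abs_mul]
    have h1 : |φ (blk Lc u) + φ (blk Lc (u + unitVec κ))| ≤ 2 * Bφ :=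
      (abs_add_le _ _).trans (by linarith [hφ (blk Lc u), hφ (blk Lc (u + unitVec κ))])
    exact mul_le_mul h1 (hHnb' κ u) (abs_nonneg _) (by positivity)
  -- (A) the link between the two levels, under the integral
  have hA : ∀ κ u, (∑ a, ∑' v : Site (d + 1), (∑ l, ∑' t : Site (d + 1), h l t * colH G' Lc l t a v) * colM G Lc a v κ u) = c * contourSumAdj Lc Ch κ u :=
    fun κ u => by
      rw [hc, div_mul_eq_mul_div, eq_div_iff hw, mul_comm]
      exact hA0 κ u
  simp only [hA]
  -- (B) the constant out, the bounded form to the left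
  have eB : (∑' u : Site (d + 1), ∑ κ : Fin (d + 1), c * contourSumAdj Lc Ch κ u * ((φ (blk Lc u) + φ (blk Lc (u + unitVec κ))) * Hn κ u))
      = c * ∑' u : Site (d + 1), ∑ κ : Fin (d + 1), m κ u * contourSumAdj Lc Ch κ u := by
    rw [← tsum_mul_left]
    refine tsum_congr fun u => ?_
    rw [Finset.mul_sum]
    exact Finset.sum_congr rfl fun κ _ => by ring
  rw [eB]
  -- (C) adjointness of the contour block sum (bounded fine form, absolutely summable coarse form)
  have hChs : ∀ κ, Summable fun Y : Site (d + 1) => |Ch κ Y| := fun κ => summable_abs_multResponse (toSite (ctrOff (d + 1) Lc)) (j + 1) hh κ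
  have hφq : ∀ κ, Summable fun u : Site (d + 1) => |Ch κ (quo Lc u)| := fun κ => summable_comp_quo' hLc1 (g := fun Y => |Ch κ Y|) (hChs κ)
  rw [tsum_mul_contourSumAdj_bdd hmB hφq]
  -- (D) the bond-sum weight through the contour sum, the averaging constraint of the field response
  have hQ : ∀ κ (Y : Site (d + 1)), contourSum Lc Hn κ Y = (stepScale d Lc (j + 1))⁻¹ * n κ Y := fun κ Y => by
    rw [hHn, hG']
    exact contourSum_fieldResponse (j + 1) hn κ Y
  have eD : ∀ κ (Y : Site (d + 1)), contourSum Lc m κ Y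
      = (φ Y + φ (Y + unitVec κ)) * ((stepScale d Lc (j + 1))⁻¹ * n κ Y)
        + dz φ κ Y * ((∑ b ∈ box (d + 1) Lc, ∑ s ∈ Finset.range Lc, (if Lc ≤ b κ + s then Hn κ ((Lc : ℤ) • Y + toSite b + (s : ℤ) • unitVec κ) else 0))
            - ∑ b ∈ box (d + 1) Lc, ∑ s ∈ Finset.range Lc, (if b κ + s + 1 < Lc then Hn κ ((Lc : ℤ) • Y + toSite b + (s : ℤ) • unitVec κ) else 0)) := by
    intro κ Y
    rw [hm, contourSum_bondSum_mul hLc1 φ Hn κ Y, hQ]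
  simp only [eD]
  -- (E) split; constants
  have hb1 : ∀ κ (Y : Site (d + 1)), |(φ Y + φ (Y + unitVec κ)) * ((stepScale d Lc (j + 1))⁻¹ * n κ Y)| ≤ 2 * Bφ * (|(stepScale d Lc (j + 1))⁻¹| * Bn) := by
    intro κ Y
    rw [abs_mul, abs_mul]
    have h1 : |φ Y + φ (Y + unitVec κ)| ≤ 2 * Bφ := (abs_add_le _ _).trans (by linarith [hφ Y, hφ (Y + unitVec κ)])
    exact mul_le_mul h1 (mul_le_mul_of_nonneg_left (hn κ Y) (abs_nonneg _)) (by positivity) (by positivity)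
  have hbox : ((box (d + 1) Lc).card : ℝ) * Lc * BH ≥ 0 := by positivity
  have hb2 : ∀ κ (Y : Site (d + 1)), |dz φ κ Y * ((∑ b ∈ box (d + 1) Lc, ∑ s ∈ Finset.range Lc, (if Lc ≤ b κ + s then Hn κ ((Lc : ℤ) • Y + toSite b + (s : ℤ) • unitVec κ) else 0))
            - ∑ b ∈ box (d + 1) Lc, ∑ s ∈ Finset.range Lc, (if b κ + s + 1 < Lc then Hn κ ((Lc : ℤ) • Y + toSite b + (s : ℤ) • unitVec κ) else 0))|
      ≤ 2 * Bφ * (((box (d + 1) Lc).card : ℝ) * Lc * BH + ((box (d + 1) Lc).card : ℝ) * Lc * BH) := by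
    intro κ Y
    rw [abs_mul]
    refine mul_le_mul (KKTFluctuationEnergy.abs_dz_le hφ κ Y) ((abs_sub _ _).trans (add_le_add ?_ ?_)) (abs_nonneg _) (by positivity)
    · exact abs_partialContour_le hHnb' κ Y (fun b s => Lc ≤ b κ + s)
    · exact abs_partialContour_le hHnb' κ Y (fun b s => b κ + s + 1 < Lc)
  have hsum1 : Summable fun Y : Site (d + 1) => ∑ κ : Fin (d + 1), Ch κ Y * ((φ Y + φ (Y + unitVec κ)) * ((stepScale d Lc (j + 1))⁻¹ * n κ Y)) :=
    summable_sum fun κ _ => (summable_bdd_mul (hb1 κ) (hChs κ)).congr fun Y => mul_comm _ _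
  have hsum2 : Summable fun Y : Site (d + 1) => ∑ κ : Fin (d + 1), Ch κ Y * (dz φ κ Y
      * ((∑ b ∈ box (d + 1) Lc, ∑ s ∈ Finset.range Lc, (if Lc ≤ b κ + s then Hn κ ((Lc : ℤ) • Y + toSite b + (s : ℤ) • unitVec κ) else 0))
        - ∑ b ∈ box (d + 1) Lc, ∑ s ∈ Finset.range Lc, (if b κ + s + 1 < Lc then Hn κ ((Lc : ℤ) • Y + toSite b + (s : ℤ) • unitVec κ) else 0))) :=
    summable_sum fun κ _ => (summable_bdd_mul (hb2 κ) (hChs κ)).congr fun Y => mul_comm _ _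
  have eE : ∀ Y : Site (d + 1), (∑ κ : Fin (d + 1), Ch κ Y * ((φ Y + φ (Y + unitVec κ)) * ((stepScale d Lc (j + 1))⁻¹ * n κ Y)
        + dz φ κ Y * ((∑ b ∈ box (d + 1) Lc, ∑ s ∈ Finset.range Lc, (if Lc ≤ b κ + s then Hn κ ((Lc : ℤ) • Y + toSite b + (s : ℤ) • unitVec κ) else 0))
            - ∑ b ∈ box (d + 1) Lc, ∑ s ∈ Finset.range Lc, (if b κ + s + 1 < Lc then Hn κ ((Lc : ℤ) • Y + toSite b + (s : ℤ) • unitVec κ) else 0))))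
      = (∑ κ : Fin (d + 1), Ch κ Y * ((φ Y + φ (Y + unitVec κ)) * ((stepScale d Lc (j + 1))⁻¹ * n κ Y)))
        + ∑ κ : Fin (d + 1), Ch κ Y * (dz φ κ Y
          * ((∑ b ∈ box (d + 1) Lc, ∑ s ∈ Finset.range Lc, (if Lc ≤ b κ + s then Hn κ ((Lc : ℤ) • Y + toSite b + (s : ℤ) • unitVec κ) else 0))
            - ∑ b ∈ box (d + 1) Lc, ∑ s ∈ Finset.range Lc, (if b κ + s + 1 < Lc then Hn κ ((Lc : ℤ) • Y + toSite b + (s : ℤ) • unitVec κ) else 0))) := by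
    intro Y
    rw [← Finset.sum_add_distrib]
    exact Finset.sum_congr rfl fun κ _ => by ring
  simp only [eE]
  rw [hsum1.tsum_add hsum2, mul_add]
  have e1 : (∑' Y : Site (d + 1), ∑ κ : Fin (d + 1), Ch κ Y * ((φ Y + φ (Y + unitVec κ)) * ((stepScale d Lc (j + 1))⁻¹ * n κ Y)))
      = (stepScale d Lc (j + 1))⁻¹ * ∑' Y : Site (d + 1), ∑ κ : Fin (d + 1), Ch κ Y * ((φ Y + φ (Y + unitVec κ)) * n κ Y) := by
    rw [← tsum_mul_left]
    refine tsum_congr fun Y => ?_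
    rw [Finset.mul_sum]
    exact Finset.sum_congr rfl fun κ _ => by ring
  have e2 : c * (stepScale d Lc (j + 1))⁻¹ = (wVH d Lc (j + 1))⁻¹ := by
    rw [hc, div_mul_eq_mul_div, mul_inv_cancel₀ hs, one_div]
  rw [e1, ← mul_assoc, e2]

end C2

end Summit.QuantumFields.BalabanUV.Beta.GAN24.TwoLevelPairingIdentities

end
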